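import Summits.BirchSwinnertonDyer.Rank1Residual.GaloisImage.EigenvalueOneNormalSubgroup
import Summits.BirchSwinnertonDyer.Rank1Residual.GaloisImage.AbelianExtensionTorsion
import Literature.NumberTheory.EllipticCurves.ModPReducibilityProofs
import Literature.NumberTheory.GaloisRepresentations.ModNCyclotomicCharacter
import Literature.NumberTheory.GaloisRepresentations.RatPlaceTwoProofs
import HarnessLib

/-!
# BSD rank-≤1 residual cell: `p` odd, `E[p]` irreducible ⇒ a good prime `ℓ ≡ 1 (mod M)` with
# `a_ℓ(E) ≢ ℓ + 1 (mod p)` (a non-Eisenstein Frobenius in every cyclotomic progression)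

HONEST FRAMING (cell `b2b-bsdres-*`, run/shared/lean/b2b/bsd-rank1-residual/, verbatim): the goal
of the cell is to DELETE the COMBINATION-SHAPED residual classes for ALL analytic-rank `≤ 1` elliptic
curves over `ℚ` — "full BSD formula for every rank `≤ 1` curve in class C" assembled STRICTLY from
published theorems — so that the rank-`≤ 1` remainder becomes exactly the CONSTRUCTION-SHAPED
classes, which are TYPED (missing-input Props), NOT attempted; this is not "finishing BSD".
Prove what is provable now; shrink each hard class to its core with data; no claim beyond stated
classes.  Research routes; census output = EVIDENCE, never a Literature fact.  Unit
`b2b-bsdres-n1011-p09` (team n1011, ROUTE-1 sub-target R1-8 (ii), OWNERS row **T-R18b**, step S-B of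
`cells/n1011/skel/T-R18b.md`).  THEOREMS ONLY (no definition, no named fact, no instance); a TOOL
file about the Galois module `E[p]` — no closure value, no class theorem, no label moves.

## What this file does

For an elliptic curve `E = W/ℚ` (globally minimal model), an ODD prime `p` with `E[p]` an
IRREDUCIBLE `Γ_ℚ`-module, any modulus `M ≥ 1` and any finite set `S` of primes, there is a prime
`ℓ ∉ S`, `ℓ ≠ p`, of good reduction, with **`ℓ ≡ 1 (mod M)` and `p ∤ #Ẽ(𝔽_ℓ)`**, i.e.
`a_ℓ(E) ≢ ℓ + 1 (mod p)` (`exists_prime_one_mod_not_dvd_reductionPointCount`,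
`exists_prime_one_mod_not_dvd_frobeniusTrace_sub`).  With `M = N` (the level of the newform `f` of
`E`) this is the prime at which Drinfeld's operator `T_ℓ − ℓ − 1` — which fixes every cusp class of
`X₀(N)` when `ℓ ≡ 1 (mod N)` — acts on `f` by the `p`-adic UNIT `a_ℓ − ℓ − 1`; it is the
arithmetic input of the `p`-integrality of all modular symbols `[r]⁺_f`
(`Additive/PlusSymbolIntegrality.lean`, ROUTE-1 R1-8 (ii)).  The tree's
`not_irreducible_of_frobeniusTrace_congr_holds` is the case `M = 1`.

Proof — every input is a tree THEOREM:
* (`isOpen_ker_modNCyclotomicCharacter`) the kernel `H = Gal(\bar ℚ/ℚ(μ_M))` of the mod-`M`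
  cyclotomic character `χ_M` (`modNCyclotomicCharacter`) is an open normal subgroup containing the
  commutator subgroup.
* (`exists_ker_cyclotomic_forall_smul_ne`) some `σ ∈ H` fixes NO non-zero point of `E[p]`:
  otherwise, by the relative invariant-line lemma
  (`exists_fixed_or_exists_stable_addSubgroup_of_natCard_eq_sq`, file
  `EigenvalueOneNormalSubgroup`) and irreducibility, `H` has a common non-zero fixed point `P`, fixed
  in particular by `[Γ_ℚ, Γ_ℚ] ≤ H` — contradicting the cell's T-R18a
  `geomTorsion_eq_zero_of_commutator_fixed_of_irreducible` (`p` odd: complex conjugation).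
* (`exists_framedArtinRep_geomTorsion_prod_cyclotomic`) the permutation Artin representation of
  `Γ_ℚ` on the finite set `E[p] × (ℤ/M)ˣ` (second factor through `χ_M`): open kernel, and
  `ρ x = ρ y` forces `x = y` on `E[p]` and `χ_M x = χ_M y` (copy of the tree's
  `exists_framedArtinRep_geomTorsion`).
* (main theorem) **Frobenius' density theorem in division form**, PROVED in the tree
  (`FramedGaloisRep.infinite_setOf_frobenius_mem_division`): infinitely many places `v` carry an
  arithmetic Frobenius `Φ` with `ρ Φ = ρ σ^k`, `(k, ord ρ σ) = 1`; discard the finitely many over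
  `S ∪ {p} ∪ {ℓ ∣ Δ_min} ∪ {ℓ ∣ M}`.  Then `χ_M(Φ) = χ_M(σ)^k = 1`, so `ℓ ≡ 1 (mod M)`
  (`modNCyclotomicCharacter_eq_residueCard_of_isArithFrobAt`: `χ_M(Frob_ℓ) = ℓ`); and if
  `p ∣ #Ẽ(𝔽_ℓ)` then `Φ` fixes a non-zero `P ∈ E[p]` (reduction of torsion,
  `exists_frobenius_smul_eq_of_dvd_reductionPointCount_holds`), hence so does `Φ^j`, which acts on
  `E[p]` as `σ` (`exists_pow_eq_self_of_coprime`) — contradiction.  Only "no eigenvalue `1`" is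
  transported, and it is stable under coprime powers, so Chebotarev's theorem is not needed.

## References

* V. G. Drinfeld, *Two theorems on modular curves*, Funct. Anal. Appl. 7 (1973) 155–156 (the
  operator `T_ℓ − ℓ − 1`, `ℓ ≡ 1 (mod N)`); Ju. I. Manin, *Parabolic points and zeta functions of
  modular curves*, Izv. 36 (1972), §3. [Manin1972]
* J.-P. Serre, *Propriétés galoisiennes des points d'ordre fini des courbes elliptiques*, Invent.
  Math. 15 (1972), §2, §5. [Serre1972]
* D. A. Marcus, *Number Fields*, 2nd ed. (2018), Ch. 7, Exercise 12 (f) (Frobenius density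
  theorem). [Marcus2018]
* Cell files: `cells/n1011/skel/T-R18b.md` S-B; `cells/n1011/ROUTE-1.md` §15.4 R1-8.
-/

noncomputable section

open scoped Classical NumberField IntermediateField
open NumberField IsDedekindDomain IsDedekindDomain.HeightOneSpectrum Field WeierstrassCurve
  Rat.HeightOneSpectrum
open Literature.NumberTheory.EllipticCurves Literature.NumberTheory.GaloisRepresentations

namespace Summit.BirchSwinnertonDyer.Rank1Residual.GaloisImage

/-! ### The kernel of the mod `M` cyclotomic character -/

/-- The kernel `Gal(\bar ℚ/ℚ(μ_M))` of the mod `M` cyclotomic character is open: it contains the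
open subgroup `Gal(\bar ℚ/ℚ(ζ))`, `ζ` a primitive `M`-th root of unity
(`modNCyclotomicCharacter_eq_one_of_mem_fixingSubgroup`, `IntermediateField.fixingSubgroup_isOpen`).
[folklore] -/
theorem isOpen_ker_modNCyclotomicCharacter (M : ℕ) [NeZero M] :
    IsOpen ((modNCyclotomicCharacter ℚ M).ker : Set (absoluteGaloisGroup ℚ)) := by
  obtain ⟨ζ, hζ⟩ := HasEnoughRootsOfUnity.exists_primitiveRoot (AlgebraicClosure ℚ) M
  haveI : FiniteDimensional ℚ ℚ⟮ζ⟯ :=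
    IntermediateField.adjoin.finiteDimensional ((hζ.isIntegral (Nat.pos_of_neZero _)).tower_top)
  refine Subgroup.isOpen_mono (H₁ := IntermediateField.fixingSubgroup ℚ⟮ζ⟯) (fun σ hσ ↦ ?_)
    (IntermediateField.fixingSubgroup_isOpen ℚ⟮ζ⟯)
  exact MonoidHom.mem_ker.mpr (modNCyclotomicCharacter_eq_one_of_mem_fixingSubgroup ℚ M hζ σ hσ)

/-- The commutator subgroup of `Γ_ℚ` lies in the kernel of the cyclotomic character (its target
`(ℤ/M)ˣ` is commutative): `ℚ(μ_M)/ℚ` is abelian. [folklore] -/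
theorem commutator_le_ker_modNCyclotomicCharacter (M : ℕ) [NeZero M] :
    commutator (absoluteGaloisGroup ℚ) ≤ (modNCyclotomicCharacter ℚ M).ker :=
  Abelianization.commutator_subset_ker _

/-! ### An element of `Gal(\bar ℚ/ℚ(μ_M))` without fixed points on `E[p]` -/

variable (W : WeierstrassCurve ℚ) [W.IsElliptic] (p : ℕ) [hp : Fact p.Prime]

/-- **`p` odd, `E[p]` irreducible ⇒ some `σ ∈ Gal(\bar ℚ/ℚ(μ_M))` fixes no non-zero point of
`E[p]`** (i.e. `ρ̄_{E,p}(σ)` does not have the eigenvalue `1`).  Otherwise every element of the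
normal subgroup `H = ker χ_M` fixes a non-zero point; by the relative invariant-line lemma
(`exists_fixed_or_exists_stable_addSubgroup_of_natCard_eq_sq`, `#E[p] = p²`) either `E[p]` has a
`Γ_ℚ`-stable subgroup `≠ ⊥, ⊤` (excluded by irreducibility) or `H` has a common non-zero fixed point
`P`; but `[Γ_ℚ, Γ_ℚ] ≤ H`, so `P` is fixed by the commutator subgroup and `P = 0` by T-R18a
(`geomTorsion_eq_zero_of_commutator_fixed_of_irreducible`, `p` odd). [folklore] -/
theorem exists_ker_cyclotomic_forall_smul_ne (hp2 : p ≠ 2)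
    (hirr : W.HasIrreducibleModPGaloisRep p) (M : ℕ) [NeZero M] :
    ∃ σ : absoluteGaloisGroup ℚ, modNCyclotomicCharacter ℚ M σ = 1 ∧
      ∀ P : W.geomTorsion p, σ • P = P → P = 0 := by
  by_contra hne
  push Not at hne
  set χ := modNCyclotomicCharacter ℚ M with hχ
  have hfix : ∀ σ ∈ χ.ker, ∃ P : W.geomTorsion p, P ≠ 0 ∧ σ • P = P := by
    intro σ hσ
    obtain ⟨P, hP, hP0⟩ := hne σ (MonoidHom.mem_ker.mp hσ)
    exact ⟨P, hP0, hP⟩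
  letI : Module (ZMod p) (W.geomTorsion p) := AddSubgroup.torsionBy.zmodModule
  have hcard : Nat.card (W.geomTorsion p) = p ^ 2 :=
    card_torsionPoints_eq_sq_holds W (AlgebraicClosure ℚ) (n := p) (by exact_mod_cast hp.out.ne_zero)
  rcases exists_fixed_or_exists_stable_addSubgroup_of_natCard_eq_sq hcard χ.ker hfix with
    ⟨P, hP0, hP⟩ | ⟨B, hB, hbot, htop⟩
  · exact hP0 (geomTorsion_eq_zero_of_commutator_fixed_of_irreducible W p hp2 hirr P
      fun σ hσ ↦ hP σ (commutator_le_ker_modNCyclotomicCharacter M hσ))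
  · rcases hirr B hB with h | h
    · exact hbot h
    · exact htop h

/-! ### The permutation Artin representation on `E[n] × (ℤ/M)ˣ` -/

/-- **The permutation Artin representation of `Γ_ℚ` on `E[n] × (ℤ/Mℤ)ˣ`** (`n ≠ 0`; `Γ_ℚ` acts
on the second factor by multiplication through the cyclotomic character `χ_M`): an Artin
representation `ρ : Γ_ℚ → GL_m(ℂ)` with open kernel such that `ρ x = ρ y` forces `x • P = y • P`
for all `P ∈ E[n]` AND `χ_M(x) = χ_M(y)`.  Verbatim the construction of the tree's
`exists_framedArtinRep_geomTorsion` (permutation matrices of a finite `Γ_ℚ`-set with open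
stabilisers), for the product set. [folklore] -/
theorem exists_framedArtinRep_geomTorsion_prod_cyclotomic {n : ℤ} (hn : n ≠ 0) (M : ℕ)
    [NeZero M] :
    ∃ (m : ℕ) (ρ : FramedArtinRep ℚ m),
      IsOpen (ρ.toMonoidHom.ker : Set (absoluteGaloisGroup ℚ)) ∧
        ∀ x y : absoluteGaloisGroup ℚ, ρ x = ρ y →
          (∀ P : W.geomTorsion n, x • P = y • P) ∧
            modNCyclotomicCharacter ℚ M x = modNCyclotomicCharacter ℚ M y := by
  classical
  set χ := modNCyclotomicCharacter ℚ M with hχdef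
  -- the finite `Γ_ℚ`-set `X = E[n] × (ℤ/M)ˣ`
  letI instY : MulAction (absoluteGaloisGroup ℚ) (ZMod M)ˣ := MulAction.compHom (ZMod M)ˣ χ
  have hY : ∀ (g : absoluteGaloisGroup ℚ) (u : (ZMod M)ˣ), g • u = χ g * u := fun g u ↦ rfl
  set X := (W.geomTorsion n) × (ZMod M)ˣ with hX
  haveI : Finite (W.geomTorsion n) := finite_torsionPoints_holds W (AlgebraicClosure ℚ) hn
  haveI : Finite X := by rw [hX]; infer_instance
  set m : ℕ := Nat.card X
  let e : X ≃ Fin m := Finite.equivFin X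
  -- the permutation representation `Γ_ℚ → Perm X ≃ Perm (Fin m) → Matrix → GL`
  let a : absoluteGaloisGroup ℚ →* Equiv.Perm X := MulAction.toPermHom _ X
  let π : absoluteGaloisGroup ℚ →* Equiv.Perm (Fin m) := e.permCongrHom.toMonoidHom.comp a
  let Mx : absoluteGaloisGroup ℚ →* Matrix (Fin m) (Fin m) ℂ :=
    (Matrix.permMatrixHom (n := Fin m) (R := ℂ)).comp π
  let ρ₀ : absoluteGaloisGroup ℚ →* GL (Fin m) ℂ := Mx.toHomUnits
  -- its kernel contains the open subgroup `(⋂_{P} Stab(P)) ⊓ ker χ`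
  let K : Subgroup (absoluteGaloisGroup ℚ) :=
    (⨅ P : W.geomTorsion n, MulAction.stabilizer _ (P : W.geomPoints)) ⊓ χ.ker
  have hKopen : IsOpen (K : Set (absoluteGaloisGroup ℚ)) := by
    have : (K : Set (absoluteGaloisGroup ℚ)) =
        (⋂ P : W.geomTorsion n,
          (MulAction.stabilizer (absoluteGaloisGroup ℚ) (P : W.geomPoints) : Set _)) ∩
          (χ.ker : Set (absoluteGaloisGroup ℚ)) := by
      simp only [K, Subgroup.coe_inf, Subgroup.coe_iInf]
    rw [this]
    exact (isOpen_iInter_of_finite fun P : W.geomTorsion n ↦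
      isOpen_stabilizer_point_holds W (P : W.geomPoints)).inter (isOpen_ker_modNCyclotomicCharacter M)
  have hKa : ∀ k ∈ K, a k = 1 := by
    intro k hk
    obtain ⟨hk1, hk2⟩ := Subgroup.mem_inf.mp hk
    ext ⟨P, u⟩
    · have hkP : k ∈ MulAction.stabilizer (absoluteGaloisGroup ℚ) (P : W.geomPoints) :=
        (Subgroup.mem_iInf.mp hk1) P
      rw [MulAction.mem_stabilizer_iff] at hkP
      change ((k • P : W.geomTorsion n) : W.geomPoints) = (P : W.geomPoints)
      exact hkP
    · change ((k • u : (ZMod M)ˣ) : ZMod M) = (u : ZMod M)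
      rw [hY, MonoidHom.mem_ker.mp hk2, one_mul]
  have hKρ : ∀ k ∈ K, ρ₀ k = 1 := by
    intro k hk
    ext : 1
    change Matrix.permMatrixHom (e.permCongrHom (a k)) = (1 : Matrix (Fin m) (Fin m) ℂ)
    rw [hKa k hk, map_one, map_one]
  have hcont : Continuous ρ₀ := continuous_of_isOpen_subgroup_le_ker ρ₀ K hKopen hKρ
  let ρ : FramedArtinRep ℚ m := ⟨ρ₀, hcont⟩
  refine ⟨m, ρ, ?_, fun x y hρ ↦ ?_⟩
  · exact Subgroup.isOpen_mono (H₁ := K) (fun k hk ↦ MonoidHom.mem_ker.mpr (hKρ k hk)) hKopen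
  · -- `ρ x = ρ y` forces `a x = a y`
    have hM' : Mx x = Mx y := by
      have := congr_arg (fun u : GL (Fin m) ℂ ↦ (u : Matrix (Fin m) (Fin m) ℂ)) hρ
      exact this
    have hπ : π x = π y := by
      have h1 : Equiv.Perm.permMatrix ℂ (π x)⁻¹ = Equiv.Perm.permMatrix ℂ (π y)⁻¹ := hM'
      have h2 : ((π x)⁻¹).toPEquiv = ((π y)⁻¹).toPEquiv := PEquiv.toMatrix_injective h1
      have h3 : (π x)⁻¹ = (π y)⁻¹ := by
        refine Equiv.ext fun i ↦ ?_
        have hi := congr_arg (fun q : Fin m ≃. Fin m ↦ q i) h2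
        simpa [Equiv.toPEquiv_apply] using hi
      exact inv_injective h3
    have ha : a x = a y := e.permCongrHom.injective hπ
    refine ⟨fun P ↦ ?_, ?_⟩
    · have := Equiv.congr_fun ha (P, 1)
      exact congr_arg Prod.fst this
    · have := congr_arg Prod.snd (Equiv.congr_fun ha (0, 1))
      change x • (1 : (ZMod M)ˣ) = y • (1 : (ZMod M)ˣ) at this
      rwa [hY, hY, mul_one, mul_one] at this

/-! ### The non-Eisenstein prime in the progression `ℓ ≡ 1 (mod M)` -/

/-- The residue cardinality of the place of `ℚ` containing the prime `ℓ` is `ℓ`. [folklore] -/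
theorem residueCard_eq_of_natCast_mem {v : HeightOneSpectrum (𝓞 ℚ)} {ℓ : ℕ} (hℓ : ℓ.Prime)
    (hv : (ℓ : 𝓞 ℚ) ∈ v.asIdeal) : v.residueCard = ℓ := by
  -- `N v = p_v` (as `Rat.residueCard_eq_natGenerator` of `HeckeCharacterProofs`, not imported here)
  have hres : v.residueCard = natGenerator v := by
    have h : Ideal.span {(natGenerator v : ℤ)} =
        v.asIdeal.map (Rat.IsIntegralClosure.intEquiv (𝓞 ℚ) : 𝓞 ℚ →+* ℤ) := span_natGenerator v
    rw [v.residueCard_eq_card_quotient, Nat.card_congr ((Ideal.quotientEquiv _ _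
      (Rat.IsIntegralClosure.intEquiv (𝓞 ℚ)) h).trans (Int.quotientSpanNatEquivZMod _)).toEquiv,
      Nat.card_zmod]
  rw [hres]
  exact Rat.natGenerator_eq_of_prime_mem v hℓ hv

/-- **`p` odd, `E[p]` irreducible ⇒ a good prime `ℓ ≡ 1 (mod M)`, outside any finite set, with
`p ∤ #Ẽ(𝔽_ℓ)`.**  Let `E = W/ℚ` (globally minimal), `p` an odd prime with `E[p]` irreducible,
`M ≥ 1`, `S` a finite set of primes.  Then some prime `ℓ ∉ S`, `ℓ ≠ p`, of good reduction has
`M ∣ ℓ − 1` and `p ∤ #Ẽ(𝔽_ℓ)`.  Proof: take `σ ∈ ker χ_M` fixing no non-zero point of `E[p]`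
(`exists_ker_cyclotomic_forall_smul_ne`) and the permutation Artin representation `ρ` on
`E[p] × (ℤ/M)ˣ`; by Frobenius' density theorem (division form, PROVED in the tree:
`FramedGaloisRep.infinite_setOf_frobenius_mem_division`) some place `v` outside
`S ∪ {p} ∪ {ℓ ∣ Δ_min} ∪ {ℓ ∣ M}` has an arithmetic Frobenius `Φ` with `ρ Φ = ρ σ^k`,
`(k, ord ρ σ) = 1`; so `χ_M Φ = 1`, i.e. `ℓ ≡ 1 (mod M)` (`χ_M(Frob_ℓ) = ℓ`), and `p ∣ #Ẽ(𝔽_ℓ)`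
would give a non-zero `P ∈ E[p]` fixed by `Φ` (reduction of torsion), hence by `Φ^j`, which acts
as `σ` — impossible. [folklore] -/
theorem exists_prime_one_mod_not_dvd_reductionPointCount [W.IsGloballyMinimal] (hp2 : p ≠ 2)
    (hirr : W.HasIrreducibleModPGaloisRep p) (M : ℕ) [NeZero M] (S : Set ℕ) (hS : S.Finite) :
    ∃ (ℓ : ℕ) (_ : Fact ℓ.Prime), ℓ ∉ S ∧ ℓ ≠ p ∧ W.HasGoodReductionAtPrime ℓ ∧ M ∣ ℓ - 1 ∧
      ¬ p ∣ W.reductionPointCount ℓ := by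
  have hpp : p.Prime := hp.out
  set χ := modNCyclotomicCharacter ℚ M with hχdef
  obtain ⟨σ, hσχ, hσ⟩ := exists_ker_cyclotomic_forall_smul_ne W p hp2 hirr M
  obtain ⟨m, ρ, hker, hfaith⟩ :=
    exists_framedArtinRep_geomTorsion_prod_cyclotomic W (n := p) (by exact_mod_cast hpp.ne_zero) M
  -- the excluded primes
  have hΔ0 : minimalDiscriminantInt W ≠ 0 := minimalDiscriminantInt_ne_zero W
  let S' : Set ℕ := S ∪ {ℓ | ℓ = p ∨ (ℓ : ℤ) ∣ minimalDiscriminantInt W ∨ ℓ ∣ M}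
  have hS' : S'.Finite := by
    refine hS.union ((Set.finite_le_nat (max p (max (minimalDiscriminantInt W).natAbs M))).subset ?_)
    rintro ℓ (rfl | hℓ | hℓ)
    · exact Set.mem_setOf.mpr (le_max_left _ _)
    · exact Set.mem_setOf.mpr (le_max_of_le_right (le_max_of_le_left
        (Nat.le_of_dvd (Int.natAbs_pos.mpr hΔ0) (Int.natCast_dvd.mp hℓ))))
    · exact Set.mem_setOf.mpr (le_max_of_le_right (le_max_of_le_right
        (Nat.le_of_dvd (Nat.pos_of_neZero M) hℓ)))
  -- Frobenius' theorem for `ρ` and `σ`, outside the places over `S'`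
  obtain ⟨v, ⟨-, 𝔓, h𝔓, Φ, hΦ, k, hk, hρ⟩, hvB⟩ :=
    (FramedGaloisRep.infinite_setOf_frobenius_mem_division ρ hker σ).exists_notMem_finite
      (finite_setOf_place_over S' hS')
  obtain ⟨ℓ, hℓ, hℓv⟩ := exists_prime_natCast_mem v
  have hℓS' : ℓ ∉ S' := fun hmem ↦ hvB (Set.mem_biUnion (x := ℓ) ⟨hmem, hℓ.ne_zero⟩ hℓv)
  have hℓS : ℓ ∉ S := fun h ↦ hℓS' (Or.inl h)
  have hℓp : ℓ ≠ p := fun h ↦ hℓS' (Or.inr (Or.inl h))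
  have hℓΔ : ¬ (ℓ : ℤ) ∣ minimalDiscriminantInt W := fun h ↦ hℓS' (Or.inr (Or.inr (Or.inl h)))
  have hℓM : ¬ ℓ ∣ M := fun h ↦ hℓS' (Or.inr (Or.inr (Or.inr h)))
  haveI : Fact ℓ.Prime := ⟨hℓ⟩
  have hgood : W.HasGoodReductionAtPrime ℓ := hasGoodReductionAtPrime_of_not_dvd W ℓ hℓΔ
  -- `ρ Φ = ρ (σ ^ k)`: `Φ = σ^k` on `E[p]` and `χ Φ = χ σ ^ k = 1`
  rw [← map_pow] at hρ
  obtain ⟨hΦP, hΦχ⟩ := hfaith Φ (σ ^ k) hρ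
  have hχΦ : χ Φ = 1 := by rw [hΦχ, map_pow, hσχ, one_pow]
  refine ⟨ℓ, ⟨hℓ⟩, hℓS, hℓp, hgood, ?_, fun hdvd ↦ ?_⟩
  · -- `ℓ ≡ 1 (mod M)` from `χ_M(Φ) = ℓ`
    have hprimes : ((Rat.HeightOneSpectrum.primesEquiv v : Nat.Primes) : ℕ) = ℓ :=
      primesEquiv_eq_of_natCast_mem hℓ hℓv
    have hMP : (M : absIntegers (𝓞 ℚ) ℚ) ∉ 𝔓 :=
      Rat.natCast_not_mem_of_mem_primesAbove_of_not_dvd h𝔓 (by rw [hprimes]; exact hℓM)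
    have h1 := modNCyclotomicCharacter_eq_residueCard_of_isArithFrobAt h𝔓 hMP hΦ
    rw [← hχdef, hχΦ, Units.val_one, residueCard_eq_of_natCast_mem hℓ hℓv] at h1
    -- `h1 : (1 : ZMod M) = ℓ`
    have h2 : ((ℓ - 1 : ℕ) : ZMod M) = 0 := by
      rw [Nat.cast_sub hℓ.one_le, ← h1, Nat.cast_one, sub_self]
    exact (ZMod.natCast_eq_zero_iff _ _).mp h2
  · -- `p ∣ #Ẽ(𝔽_ℓ)` would give a non-zero fixed point of `Φ`, hence of `σ`
    obtain ⟨P, hP0, hP⟩ :=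
      exists_frobenius_smul_eq_of_dvd_reductionPointCount_holds W p ℓ hℓp hgood hdvd v hℓv 𝔓 h𝔓
        Φ hΦ
    obtain ⟨j, hj⟩ := exists_pow_eq_self_of_coprime hk
    -- `ρ σ = (ρ σ ^ k) ^ j = ρ (Φ ^ j)`
    have hρ' : ρ (Φ ^ j) = ρ σ := by rw [map_pow, hρ, map_pow, hj]
    have hfix : (Φ ^ j) • P = P :=
      MulAction.mem_stabilizer_iff.mp
        (Subgroup.pow_mem (MulAction.stabilizer (absoluteGaloisGroup ℚ) P)
          (MulAction.mem_stabilizer_iff.mpr hP) j)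
    have hσP : σ • P = P := by rw [← (hfaith (Φ ^ j) σ hρ').1 P, hfix]
    exact hP0 (hσ P hσP)

/-- The same in terms of the trace of Frobenius: a good prime `ℓ ≡ 1 (mod M)`, `ℓ ∉ S`, `ℓ ≠ p`,
with `a_ℓ(E) ≢ ℓ + 1 (mod p)` (`dvd_frobeniusTrace_sub_iff`). [folklore] -/
theorem exists_prime_one_mod_not_dvd_frobeniusTrace_sub [W.IsGloballyMinimal] (hp2 : p ≠ 2)
    (hirr : W.HasIrreducibleModPGaloisRep p) (M : ℕ) [NeZero M] (S : Set ℕ) (hS : S.Finite) :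
    ∃ (ℓ : ℕ) (_ : Fact ℓ.Prime), ℓ ∉ S ∧ ℓ ≠ p ∧ W.HasGoodReductionAtPrime ℓ ∧ M ∣ ℓ - 1 ∧
      ¬ (p : ℤ) ∣ W.frobeniusTrace ℓ - (ℓ + 1) := by
  obtain ⟨ℓ, hℓ, hS', hℓp, hgood, hM, hndvd⟩ :=
    exists_prime_one_mod_not_dvd_reductionPointCount W p hp2 hirr M S hS
  exact ⟨ℓ, hℓ, hS', hℓp, hgood, hM, fun h ↦ hndvd ((dvd_frobeniusTrace_sub_iff W p ℓ).mp h)⟩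

/-- Row reading under `surj(p)` (`p` odd): surjective mod-`p` image ⇒ irreducible
(`hasIrreducibleModPGaloisRep_of_hasSurjectiveModNGaloisRep`), so the non-Eisenstein prime in the
progression exists on every tower / N11 row. [folklore] -/
theorem exists_prime_one_mod_not_dvd_frobeniusTrace_sub_of_surj [W.IsGloballyMinimal] (hp2 : p ≠ 2)
    (hsurj : W.HasSurjectiveModNGaloisRep p) (M : ℕ) [NeZero M] (S : Set ℕ) (hS : S.Finite) :
    ∃ (ℓ : ℕ) (_ : Fact ℓ.Prime), ℓ ∉ S ∧ ℓ ≠ p ∧ W.HasGoodReductionAtPrime ℓ ∧ M ∣ ℓ - 1 ∧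
      ¬ (p : ℤ) ∣ W.frobeniusTrace ℓ - (ℓ + 1) :=
  exists_prime_one_mod_not_dvd_frobeniusTrace_sub W p hp2
    (hasIrreducibleModPGaloisRep_of_hasSurjectiveModNGaloisRep W p hsurj) M S hS

end Summit.BirchSwinnertonDyer.Rank1Residual.GaloisImage

end
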